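import Summits.QuantumFields.YangMills.Theorems.SwapVirialDeficitBlowUpGnomonicCartHubFrame
import Summits.QuantumFields.YangMills.Theorems.SwapVirialDeficitBlowUpGnomonicApexSoftLine
import Summits.QuantumFields.YangMills.Theorems.VirialFluxGapAnchorChartSmooth
import HarnessLib

/-!
# Route `SwapVirialDeficit` (YangMills): ROTATING THE LETTERS IS TILTING THE HUB — `F̂_a(gnoRot w ζ) = F̂cart(w·a·w̄, ζ)`, and the soft letter line is an exact joint rotation
# (cell ym-idea-1, skeleton ➎ v14, `stub_core_tip`: foundations (F1)(F2) of w3 g68's (hCore) design (STATUS 2026-09-01 ≈01:50Z) — the tip's soft pair is the joint tilt,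
# which is a rotation of a RESCALED flat base; free-hands support of ⟨stmt-QuantumFields-24197⟩ `SwapVirialDeficit.SwapGluedStiffness`)

* §1 `rot3_one`, `rot3_rot3` (`rot3 u (rot3 v w) = rot3 (v*u) w` for units), `gnoRot_one`, `gnoRot_gnoRot`, `gnoRot_star_gnoRot` (`gnoRot ū ∘ gnoRot u = id`);
* §2 `norm_im_unit_conj`, `axisPoint_unit_conj` (conjugation by a unit preserves `re` (✓`re_conj_unit`) and `‖im‖`, hence `axisPoint`);
* §3 ★★ `gnoDeficit_gnoRot_eq_cart` — for a hub `a ≠ 0` IN STANDARD POSITION (`radialUnit (axisPoint a) = radialUnit a`, e.g. `a = angUnit θ` with `sin θ ≥ 0`, or `hubAt δ 1`),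
  central `χ` and every unit `w`: `F̂_{z,χ}(a, ε, gnoRot w ζ) = F̂cart_{z,χ}(w·a·w̄, ε, ζ)` — rotating all letters at a fixed standard hub equals tilting the hub axis at fixed letters
  (✓`gnoDeficitCart_gnoRot` + §1 + §2);
* §4 ★ `exists_gnoRot_gnoBase_eq_jointTilt` — for a base point `p` and a joint tilt `τ ∈ ℝ²`: there is a unit `u` with `rot3 u e₀ = (1, τ)/√(1+|τ|²)` and
  `gnoRot u (gnoBase (√(1+|τ|²)·p)) = ((p₁·(1,τ)), (p₂·(1,τ)), 0, 0)` = the point `gnoBase p + ξ(p₁τ, p₂τ, 0, 0)` of the soft letter line (✓`exists_rot3_e0_eq`).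
So `F̂_{angUnit θ}(gnoBase p + s·ξ_soft) = F̂cart(u_s·angUnit θ·ū_s, gnoBase (√(1+s²|e|²)·p))` with a hub displaced by `≍ sin θ·s|e|` from `angUnit θ` at a FLAT base — the input of
✓`gnoDeficitCart_le_sq_of_flat` (p-uniform soft ceiling) and of the tip-core follower matching modulo rotation.

HONEST LABEL: algebra; `stub_core_tip`, ⟨24197⟩ ∕ ⟨24194⟩ OPEN; own crux ⟨22884⟩ `LargeFieldMassRefinementTail` OPEN (blocked-on ⟨19935⟩); the Yang–Mills mass gap is NOT proved; no summit
is proved by a line.  THEOREMS ONLY (0 `def`, 0 `sorry`, no instance), standard axioms.  Width seat ym-line-sfw-p2-w3 g68 (cell ym-idea-1, free hands), `--supports stmt-QuantumFields-24197`.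
References: [cite: tHooft1979]; [folklore].
-/

set_option autoImplicit false

noncomputable section

open Quaternion Set
open scoped Quaternion
open Literature.MathematicalPhysics.QuantumLattice
open Literature.MathematicalPhysics.QuantumFieldTheory hiding SU2

namespace Summit.QuantumFields.YangMills.Theorems.SwapVirialDeficit.BlowUpRing

open Summit.QuantumFields.YangMills.Theorems.FemtoTransferGap
open Summit.QuantumFields.YangMills.Theorems.FemtoTransferGap.TT
open Literature.Analysis.Calculus (radialUnit radialUnit_def norm_radialUnit)
open Summit.QuantumFields.YangMills.Theorems.SwapTwistDeficit.ToronLog (axisPoint)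
open Summit.QuantumFields.YangMills.Theorems.SwapVirialDeficit.Gnomonic (normSq3)

variable {L : ℕ} [NeZero L]

/-! ## §1 The group law of `rot3` ∕ `gnoRot` -/

omit [NeZero L] in
/-- `rot3 1 = id`. [folklore] -/
theorem rot3_one (w : Fin 3 → ℝ) : rot3 (1 : ℍ) w = w := by
  ext i
  fin_cases i <;> simp [rot3, gnomonicQuat]

omit [NeZero L] in
/-- `rot3 u (rot3 v w) = rot3 (v * u) w` for units `u, v` (conjugation by `ū` after conjugation by `v̄`). [folklore] -/
theorem rot3_rot3 {u v : ℍ} (_hu : ‖u‖ = 1) (hv : ‖v‖ = 1) (w : Fin 3 → ℝ) : rot3 u (rot3 v w) = rot3 (v * u) w := by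
  have key : star u * gnomonicQuat (rot3 v w) * u = star (v * u) * gnomonicQuat w * (v * u) := by
    rw [gnomonicQuat_rot3 hv, star_mul]; simp only [mul_assoc]
  show (![(star u * gnomonicQuat (rot3 v w) * u).imI, (star u * gnomonicQuat (rot3 v w) * u).imJ, (star u * gnomonicQuat (rot3 v w) * u).imK] : Fin 3 → ℝ) =
    ![(star (v * u) * gnomonicQuat w * (v * u)).imI, (star (v * u) * gnomonicQuat w * (v * u)).imJ, (star (v * u) * gnomonicQuat w * (v * u)).imK]
  rw [key]

omit [NeZero L] in
/-- `gnoRot 1 = id`. [folklore] -/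
theorem gnoRot_one (η : GnoCoord L) : gnoRot (1 : ℍ) η = η := by
  obtain ⟨⟨x, y⟩, z, F⟩ := η
  simp only [gnoRot, rot3_one]

omit [NeZero L] in
/-- `gnoRot u (gnoRot v η) = gnoRot (v * u) η` for units. [folklore] -/
theorem gnoRot_gnoRot {u v : ℍ} (hu : ‖u‖ = 1) (hv : ‖v‖ = 1) (η : GnoCoord L) : gnoRot u (gnoRot v η) = gnoRot (v * u) η := by
  obtain ⟨⟨x, y⟩, z, F⟩ := η
  simp only [gnoRot, rot3_rot3 hu hv]

omit [NeZero L] in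
/-- `gnoRot ū (gnoRot u η) = η` for a unit `u`. [folklore] -/
theorem gnoRot_star_gnoRot {u : ℍ} (hu : ‖u‖ = 1) (η : GnoCoord L) : gnoRot (star u) (gnoRot u η) = η := by
  have hsu : ‖star u‖ = 1 := by rw [norm_star]; exact hu
  rw [gnoRot_gnoRot hsu hu, (star_mul_self_of_unit hu).2, gnoRot_one]

/-! ## §2 Conjugation by a unit preserves the axis data -/

omit [NeZero L] in
/-- `‖im (w q w̄)‖ = ‖im q‖` for a unit `w`. [folklore] -/
theorem norm_im_unit_conj {w : ℍ} (hw : ‖w‖ = 1) (q : ℍ) : ‖(w * q * star w).im‖ = ‖q.im‖ := by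
  have hsw : ‖star w‖ = 1 := by rw [norm_star]; exact hw
  have hn : ‖w * q * star w‖ = ‖q‖ := by rw [norm_mul, norm_mul, hw, hsw, one_mul, mul_one]
  have hre := VirialFluxGap.AnchorSlice.re_conj_unit hw q
  have hfull : ∀ r : ℍ, ‖r‖ ^ 2 = r.re ^ 2 + r.imI ^ 2 + r.imJ ^ 2 + r.imK ^ 2 := fun r => by
    rw [sq, ← Quaternion.normSq_eq_norm_mul_self, Quaternion.normSq_def']
  have h1 := WeakCouplingRates.sq_norm_im (w * q * star w)
  have h2 := WeakCouplingRates.sq_norm_im q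
  have h3 : ‖(w * q * star w).im‖ ^ 2 = ‖q.im‖ ^ 2 := by
    have e1 := hfull (w * q * star w)
    have e2 := hfull q
    rw [hn, hre] at e1
    linarith
  exact (sq_eq_sq₀ (norm_nonneg _) (norm_nonneg _)).1 h3

omit [NeZero L] in
/-- `axisPoint (w q w̄) = axisPoint q` for a unit `w`. [folklore] -/
theorem axisPoint_unit_conj {w : ℍ} (hw : ‖w‖ = 1) (q : ℍ) : axisPoint (w * q * star w) = axisPoint q := by
  unfold axisPoint
  rw [VirialFluxGap.AnchorSlice.re_conj_unit hw, norm_im_unit_conj hw]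

/-! ## §3 Rotating the letters at a standard hub = tilting the hub at fixed letters -/

/-- ★★ **ROTATING ALL LETTERS AT A STANDARD HUB IS TILTING THE HUB AXIS AT FIXED LETTERS**: for `a ≠ 0` in standard position (`radialUnit (axisPoint a) = radialUnit a`),
central `χ` and a unit `w`, `F̂_{z,χ}(a, ε, gnoRot w ζ) = F̂cart_{z,χ}(w·a·w̄, ε, ζ)` (✓`gnoDeficitCart_gnoRot` at the hub `w a w̄`, whose axis point is that of `a`, with the frame `w̄`).
[cite: tHooft1979] -/
theorem gnoDeficit_gnoRot_eq_cart (z : Fin 3 → Bool) {χ : Site 3 L → SU2} (hχ : ∀ (x : Site 3 L) (k : SU2), k * χ x = χ x * k) {a : ℍ} (ha : a ≠ 0)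
    (hstd : radialUnit (axisPoint a) = radialUnit a) {w : ℍ} (hw : ‖w‖ = 1) (ε : GnoSign L) (ζ : GnoCoord L) :
    gnoDeficit z χ a ε (gnoRot w ζ) = gnoDeficitCart z χ (w * a * star w) ε ζ := by
  set a' : ℍ := w * a * star w with ha'
  have hsw : ‖star w‖ = 1 := by rw [norm_star]; exact hw
  obtain ⟨hww, hww'⟩ := star_mul_self_of_unit hw
  have ha'0 : a' ≠ 0 := by
    intro h
    have hn : ‖a'‖ = ‖a‖ := by rw [ha', norm_mul, norm_mul, hw, hsw, one_mul, mul_one]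
    rw [h, norm_zero] at hn
    exact ha (norm_eq_zero.1 hn.symm)
  -- the frame `w̄` of `a'`: `w · radialUnit (axisPoint a') · w̄ = radialUnit a'`
  have hax : axisPoint a' = axisPoint a := axisPoint_unit_conj hw a
  have hra' : radialUnit a' = w * radialUnit a * star w := by
    rw [radialUnit_def, radialUnit_def, ha', norm_mul, norm_mul, hw, hsw, one_mul, mul_one, mul_smul_comm, smul_mul_assoc]
  have hframe : star (star w) * radialUnit (axisPoint a') * star w = radialUnit a' := by
    rw [star_star, hax, hstd, hra']
  -- ✓`gnoDeficitCart_gnoRot` at `a'` with the frame `w̄`, applied to `gnoRot w ζ`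
  have h := gnoDeficitCart_gnoRot z hχ ha'0 hsw hframe ε (gnoRot w ζ)
  rw [gnoRot_star_gnoRot hw] at h
  -- `F̂_{a'} = F̂_a` (same axis point)
  have hsame : gnoDeficit z χ a' ε (gnoRot w ζ) = gnoDeficit z χ a ε (gnoRot w ζ) := by
    unfold gnoDeficit
    exact congrArg (chartDeficit L z χ) (blowUpPoint_gnomonicPoint_eq_of_axisUnit_eq (a := a') (a' := a) (by rw [hax]) ε (gnoRot w ζ))
  rw [← hsame, ← h]

/-! ## §4 The soft letter line is an exact joint rotation of a rescaled flat base -/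

omit [NeZero L] in
/-- ★ **THE SOFT LETTER LINE IS A ROTATED RESCALED FLAT BASE**: for a base point `p` and a joint tilt `τ : Fin 2 → ℝ`, with `λ = √(1 + τ₀² + τ₁²)`, there is a unit `u` with
`rot3 u e₀ = (1, τ₀, τ₁)/λ` and `gnoRot u (gnoBase (λp₁) (λp₂)) = ((p₁·(1, τ₀, τ₁)), (p₂·(1, τ₀, τ₁)), 0, 0)` — the point `gnoBase p + ξ(p₁τ, p₂τ, 0, 0)` of the soft letter line.
[folklore] -/
theorem exists_gnoRot_gnoBase_eq_jointTilt (p : ℝ × ℝ) (τ : Fin 2 → ℝ) :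
    ∃ u : ℍ, ‖u‖ = 1 ∧ rot3 u ![1, 0, 0] = (Real.sqrt (1 + (τ 0 ^ 2 + τ 1 ^ 2)))⁻¹ • (![1, τ 0, τ 1] : Fin 3 → ℝ) ∧
      gnoRot u (gnoBase (Real.sqrt (1 + (τ 0 ^ 2 + τ 1 ^ 2)) * p.1) (Real.sqrt (1 + (τ 0 ^ 2 + τ 1 ^ 2)) * p.2) : GnoCoord L) =
        ((((![p.1, p.1 * τ 0, p.1 * τ 1] : Fin 3 → ℝ), (![p.2, p.2 * τ 0, p.2 * τ 1] : Fin 3 → ℝ)), ((0 : Fin 3 → ℝ), (0 : Fol L → Fin 3 → ℝ))) : GnoCoord L) := by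
  set lam : ℝ := Real.sqrt (1 + (τ 0 ^ 2 + τ 1 ^ 2)) with hlam
  have hlam0 : 0 < lam := Real.sqrt_pos.2 (by positivity)
  have hlam2 : lam ^ 2 = 1 + (τ 0 ^ 2 + τ 1 ^ 2) := Real.sq_sqrt (by positivity)
  set n : Fin 3 → ℝ := lam⁻¹ • (![1, τ 0, τ 1] : Fin 3 → ℝ) with hn
  have hnvec : n = (![lam⁻¹, lam⁻¹ * τ 0, lam⁻¹ * τ 1] : Fin 3 → ℝ) := by
    rw [hn]; ext i; fin_cases i <;> simp
  have hn1 : normSq3 n = 1 := by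
    have e : normSq3 n = lam⁻¹ ^ 2 * (1 + (τ 0 ^ 2 + τ 1 ^ 2)) := by
      rw [hnvec]; unfold normSq3; rw [Fin.sum_univ_three]
      simp only [Matrix.cons_val_zero, Matrix.cons_val_one, Matrix.cons_val_two, Matrix.head_cons, Matrix.tail_cons]
      ring
    rw [e, ← hlam2, inv_pow, inv_mul_cancel₀ (pow_ne_zero 2 hlam0.ne')]
  obtain ⟨u, hu, hrot⟩ := exists_rot3_e0_eq n hn1
  refine ⟨u, hu, hrot, ?_⟩
  have hx : ∀ c : ℝ, rot3 u (![lam * c, 0, 0] : Fin 3 → ℝ) = (![c, c * τ 0, c * τ 1] : Fin 3 → ℝ) := by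
    intro c
    have e : (![lam * c, 0, 0] : Fin 3 → ℝ) = (lam * c) • (![1, 0, 0] : Fin 3 → ℝ) := by
      ext i; fin_cases i <;> simp
    have hc : lam * c * lam⁻¹ = c := by field_simp
    rw [e, rot3_smul, hrot, hn, smul_smul, hc]
    ext i; fin_cases i <;> simp
  simp only [gnoRot, gnoBase, hx, rot3_zero]
  refine Prod.ext rfl (Prod.ext rfl ?_)
  funext f
  exact rot3_zero u

end Summit.QuantumFields.YangMills.Theorems.SwapVirialDeficit.BlowUpRing

end
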